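import Literature.Geometry.Symplectic.JCurveIntersectionCountHomologicalProofs

/-!
# Stub `stub_factCountHomological` of line `cross-cap-laurent` (crux `GromovRecognitionRelEnd`,
item stmt-SmoothPoincare4-11009): the vendored fact F6 (the wedge count of a `J`-sphere against a
compact `J`-holomorphic zero set factors through homology) is now PROVED in the Literature tree
(`Literature.Geometry.Symplectic.jSphere_wedgeCount_factorsThroughHomology_holds`); the stub is
discharged by that theorem.
-/

-- the prescribed namespace `Summit.<P>.<Sub>.…` duplicates `SmoothPoincare4` (P = Sub)
set_option linter.dupNamespace false

namespace Summit.SmoothPoincare4.SmoothPoincare4.Theorems.GromovRecognitionRelEnd.CrossCapLaurent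

/-- **Stub F6 (registered `stub_factCountHomological`)**: homological wedge counts, discharged by
the Literature proof. -/
theorem stub_factCountHomological :
    Literature.Geometry.Symplectic.jSphere_wedgeCount_factorsThroughHomology :=
  Literature.Geometry.Symplectic.jSphere_wedgeCount_factorsThroughHomology_holds

end Summit.SmoothPoincare4.SmoothPoincare4.Theorems.GromovRecognitionRelEnd.CrossCapLaurent
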